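import Summits.Parity.BatemanHorn.Theorems.SystemLSDRealSegment.Negative.LoadBearing

/-!
# Stub S6 `stub_roughMajorant` of line `smooth-rough-lattice-acquisition` — all four fields of `IsBatemanHornSystem` are load-bearing

Negative-side theorems (refuter, drefute gen 2, 2026-08-16) for the HARDEST stub of the line
`Cruxes/SystemZeroRepulsion/Lines/smooth-rough-lattice-acquisition.lean` of the crux
`Summit.Parity.BatemanHorn.Theses.AlmostPrimeZeros.SystemZeroRepulsion` (stmt-Parity-11291):

  S6  `∀ (k,f), IsBatemanHornSystem f → ∀ m₀, ∃ A C x₀, ∀ x ≥ x₀, ∀ z, ‖z−1‖ ≤ 3 log log x →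
       ‖Σ_{m₀ ≤ n ≤ x} z^{s♯_x(n)}‖ ≤ A·x·U^{k(Re z−1)}·exp(C‖z−1‖ log(‖z−1‖+2))`,
  `U = log x / log log log x`, `s♯_x(n) = Σ_i Σ_{p > log log x} min(v_p(f_i(n)), 2)` (typed through `Int.toNat`,
  `Nat.factorization`).

For each field `H` of `IsBatemanHornSystem` we state S6 WITH `H` DROPPED (conclusion inlined verbatim from the skeleton,
sha 5e06eb842271) and refute it at the single point `z = −1`, `m₀ = 0`, where the budget is
`A·x·U^{−2k}·e^{2C log 4} = o(x)` (`U → ∞`, `tendsto_U_atTop`, `eventually_budget_lt`) while the witness makes every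
term of the rough sum equal to `(−1)^{even} = 1`, so that the sum is `x + 1`:

* `stubRoughMajorant_false_without_irreducible` — `![X ^ 2]`: `s♯(n²) = 2·#{p > L : p ∣ n}` is even;
* `stubRoughMajorant_false_without_pairwise_not_associated` — `![X, X]`: `s♯ = 2 s♯_X(n)` is even;
* `stubRoughMajorant_false_without_leadingCoeff_pos` — `![-X]`: `toNat(−n) = 0`, `s♯ ≡ 0` (the typed encoding makes
  positivity load-bearing; the gen-1 drefute note "lc > 0 cosmetic" is wrong for S6 as typed);
* `stubRoughMajorant_false_without_hasNoFixedPrimeDivisor` — the CONSTANT prime `![C 3]` (irreducible in `ℤ[X]`):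
  once `log log x ≥ 3` the prime `3` is smooth and `s♯ ≡ 0`. So "the line proves the crux for the larger class
  {irreducible, lc > 0, pairwise non-associated}" (gen-1 drefute, cross-cutting finding 1) needs "non-constant": within
  `IsBatemanHornSystem` only `hasNoFixedPrimeDivisor` excludes the constant primes.

None of the four witnesses is a Bateman–Horn system, so nothing here bears on S6 itself (open, parity-hard for
`deg ≥ 2`); the theorems say which hypotheses any proof of S6 must consume, and that the first two are consumed through
PARITY (even statistic, no cancellation at `z = −1`) while the last two are consumed only through the typed conventions
(`Int.toNat` of non-positive values; constants count as irreducible). Helpers reused from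
`Theorems/SystemLSDRealSegment/Negative/LoadBearing.lean` (`polyRootCountMod_eq_one`, `sq_dvd_iff`, `pair_dvd_iff`,
`negX_dvd_iff`, `C_three_other_fields`) and `…/Engines.lean` (`tendsto_loglog_atTop`).
-/

noncomputable section

open Filter Polynomial Finset
open scoped Topology

namespace Summit.Parity.BatemanHorn.Theorems.SystemZeroRepulsion.Negative

open Literature.NumberTheory.Sieve
open Summit.Parity.BatemanHorn.Theorems.SystemLSDRealSegment.Negative

/-! ## Analytic core: the S6 budget at `z = -1` is `o(x)` -/

/-- `t / log (log t) → +∞` (since `0 < log log t ≤ log t` eventually and `t / log t → +∞`; the latter is inlined —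
it is `Literature.NumberTheory.Sieve.GoldbachLinnik.tendsto_div_log_atTop`, not imported to keep this file light). [folklore] -/
theorem tendsto_div_loglog_atTop : Tendsto (fun t : ℝ => t / Real.log (Real.log t)) atTop atTop := by
  have hdivlog : Tendsto (fun t : ℝ => t / Real.log t) atTop atTop := by
    have h0 : Tendsto (fun t : ℝ => Real.log t ^ 1 / (1 * t + 0)) atTop (𝓝 0) :=
      Real.tendsto_pow_log_div_mul_add_atTop 1 0 1 one_ne_zero
    have h1 : Tendsto (fun t : ℝ => Real.log t / t) atTop (𝓝[>] 0) := by
      refine tendsto_nhdsWithin_iff.2 ⟨h0.congr fun t => by simp, ?_⟩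
      filter_upwards [eventually_gt_atTop 1] with t ht
      exact div_pos (Real.log_pos ht) (by linarith)
    exact (tendsto_inv_nhdsGT_zero.comp h1).congr fun t => by simp [inv_div]
  refine tendsto_atTop_mono' atTop ?_ hdivlog
  filter_upwards [eventually_gt_atTop (Real.exp (Real.exp 1))] with t ht
  have he1 : 0 < Real.exp 1 := Real.exp_pos 1
  have ht0 : 0 < t := lt_trans (Real.exp_pos _) ht
  have hlog : Real.exp 1 < Real.log t := by
    rw [← Real.log_exp (Real.exp 1)]; exact Real.log_lt_log (Real.exp_pos _) ht
  have hlog0 : 0 < Real.log t := lt_trans he1 hlog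
  have hll : 0 < Real.log (Real.log t) := by
    have : 1 < Real.log t := lt_trans (by have := Real.add_one_le_exp (1:ℝ); linarith) hlog
    exact Real.log_pos this
  have hle : Real.log (Real.log t) ≤ Real.log t := by
    have := Real.log_le_sub_one_of_pos hlog0; linarith
  exact div_le_div_of_nonneg_left ht0.le hll hle

/-- `U(x) = log x / log log log x → +∞` along the naturals. [folklore] -/
theorem tendsto_U_atTop :
    Tendsto (fun x : ℕ => Real.log (x : ℝ) / Real.log (Real.log (Real.log (x : ℝ)))) atTop atTop :=
  tendsto_div_loglog_atTop.comp (Real.tendsto_log_atTop.comp tendsto_natCast_atTop_atTop)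

/-- The S6 budget at `z = -1` is eventually `o(x)`: for every `A C`, `k ≥ 1`, `m₀`, eventually in `x`,
`2 ≤ 3 log log x` and `A·x·U^{k(Re(-1)-1)}·exp(C‖-1-1‖ log(‖-1-1‖+2)) < x + 1 - m₀`. [folklore] -/
theorem eventually_budget_lt (A C : ℝ) {k : ℕ} (hk : 1 ≤ k) (m₀ : ℕ) :
    ∀ᶠ x : ℕ in atTop, 2 ≤ 3 * Real.log (Real.log (x : ℝ)) ∧
      A * (x : ℝ) * (Real.log (x : ℝ) / Real.log (Real.log (Real.log (x : ℝ)))) ^ ((k : ℝ) * ((-1 : ℂ).re - 1)) *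
          Real.exp (C * ‖(-1 : ℂ) - 1‖ * Real.log (‖(-1 : ℂ) - 1‖ + 2)) < (x : ℝ) + 1 - m₀ := by
  set B : ℝ := Real.exp (C * ‖(-1 : ℂ) - 1‖ * Real.log (‖(-1 : ℂ) - 1‖ + 2)) with hB
  have hB0 : 0 < B := Real.exp_pos _
  set M : ℝ := 2 * |A| * B + 1 with hM
  have hM1 : 1 ≤ M := by
    have h2 : (0 : ℝ) ≤ 2 * |A| * B := by positivity
    linarith
  have hre : ((-1 : ℂ).re - 1) = -2 := by norm_num
  filter_upwards [tendsto_loglog_atTop.eventually (eventually_ge_atTop 1),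
    tendsto_U_atTop.eventually (eventually_ge_atTop M), eventually_ge_atTop (2 * m₀ + 1)] with x hLL hU hx
  refine ⟨by linarith, ?_⟩
  set U : ℝ := Real.log (x : ℝ) / Real.log (Real.log (Real.log (x : ℝ))) with hUdef
  have hU1 : 1 ≤ U := le_trans hM1 hU
  have hU0 : 0 < U := lt_of_lt_of_le one_pos hU1
  have hx0 : (0 : ℝ) < x := by exact_mod_cast (show 0 < x by omega)
  have hxm : (x : ℝ) / 2 ≤ (x : ℝ) + 1 - m₀ := by
    have : (2 * m₀ + 1 : ℝ) ≤ x := by exact_mod_cast hx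
    linarith
  -- the rpow factor is at most U⁻¹ ≤ 1/M
  have hpow : U ^ ((k : ℝ) * ((-1 : ℂ).re - 1)) ≤ U⁻¹ := by
    rw [hre, ← Real.rpow_neg_one]
    refine Real.rpow_le_rpow_of_exponent_le hU1 ?_
    have : (1 : ℝ) ≤ k := by exact_mod_cast hk
    nlinarith
  have hpow0 : 0 ≤ U ^ ((k : ℝ) * ((-1 : ℂ).re - 1)) := Real.rpow_nonneg hU0.le _
  have hinvM : U⁻¹ ≤ M⁻¹ := inv_anti₀ (by linarith) hU
  calc A * (x : ℝ) * U ^ ((k : ℝ) * ((-1 : ℂ).re - 1)) * B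
      ≤ |A| * (x : ℝ) * U ^ ((k : ℝ) * ((-1 : ℂ).re - 1)) * B := by
        gcongr ?_ * _ * _ * _
        exact le_abs_self A
    _ ≤ |A| * (x : ℝ) * M⁻¹ * B := by gcongr; exact hpow.trans hinvM
    _ = (|A| * B / M) * x := by ring
    _ < (1 / 2) * x := by
        refine mul_lt_mul_of_pos_right ?_ hx0
        rw [div_lt_iff₀ (by linarith)]
        nlinarith [abs_nonneg A]
    _ ≤ (x : ℝ) + 1 - m₀ := by linarith


/-! ## Statistic computations for the three witnesses at `z = -1` -/

/-- `-X`: every value on `ℕ` is `≤ 0`, so the typed rough statistic vanishes (`Int.toNat`). [folklore] -/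
theorem roughStat_negX (L : ℝ) (n : ℕ) :
    (∑ i, ((((![-X] : Fin 1 → ℤ[X]) i).eval (n : ℤ)).toNat.factorization.sum
      fun p v => if L < (p : ℝ) then min v 2 else 0)) = 0 := by
  simp

/-- `X²`: the rough capped statistic of `n²` is even (each rough prime of `n` contributes `min(2v,2) = 2`). [folklore] -/
theorem two_dvd_roughStat_sq (L : ℝ) (n : ℕ) :
    2 ∣ (∑ i, ((((![X ^ 2] : Fin 1 → ℤ[X]) i).eval (n : ℤ)).toNat.factorization.sum
      fun p v => if L < (p : ℝ) then min v 2 else 0)) := by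
  simp only [Fin.sum_univ_one, Matrix.cons_val_fin_one, eval_pow, eval_X]
  rw [← Nat.cast_pow, Int.toNat_natCast, Nat.factorization_pow,
    Finsupp.sum_smul_index' (fun p => by simp), Finsupp.sum]
  refine Finset.dvd_sum fun p hp => ?_
  have h1 : 0 < n.factorization p := by
    rw [Nat.support_factorization] at hp
    obtain ⟨hp', hpn, hn⟩ := Nat.mem_primeFactors.1 hp
    exact hp'.factorization_pos_of_dvd hn hpn
  simp only [smul_eq_mul]
  split_ifs
  · exact ⟨1, by omega⟩
  · exact dvd_zero 2

/-- `(X, X)`: the rough capped statistic is twice that of `X`, hence even. [folklore] -/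
theorem two_dvd_roughStat_pair (L : ℝ) (n : ℕ) :
    2 ∣ (∑ i, ((((![X, X] : Fin 2 → ℤ[X]) i).eval (n : ℤ)).toNat.factorization.sum
      fun p v => if L < (p : ℝ) then min v 2 else 0)) := by
  simp only [Fin.sum_univ_two, Matrix.cons_val_zero, Matrix.cons_val_one, eval_X, Int.toNat_natCast]
  exact ⟨_, (two_mul _).symm⟩

/-- A sum of `(-1)^{e(n)}` with every `e(n)` even, over `Ico m₀ (x+1)`, has norm `x + 1 - m₀`. [folklore] -/
theorem norm_sum_neg_one_pow_of_even {e : ℕ → ℕ} (he : ∀ n, 2 ∣ e n) (m₀ x : ℕ) :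
    ‖∑ n ∈ Finset.Ico m₀ (x + 1), (-1 : ℂ) ^ (e n)‖ = ((x + 1 - m₀ : ℕ) : ℝ) := by
  have h1 : ∀ n ∈ Finset.Ico m₀ (x + 1), (-1 : ℂ) ^ (e n) = 1 := fun n _ =>
    Even.neg_one_pow (even_iff_two_dvd.2 (he n))
  rw [Finset.sum_congr rfl h1, Finset.sum_const, Nat.card_Ico, nsmul_eq_mul, mul_one, Complex.norm_natCast]

/-! ## The three load-bearing theorems for stub S6 `stub_roughMajorant` -/

/-- DROP `irreducible` ⇒ S6 FALSE. Witness `k = 1`, `f = ![X²]` (leading coefficient `1`, `ω(p) = 1 < p`,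
pairwise vacuous), `m₀ = 0`, `z = -1`: the rough statistic is even, so `R_x(0;-1) = x + 1`, while the budget
`A x U^{-2} e^{2C log 4}` is `o(x)` (`U = log x/log log log x → ∞`). [folklore] -/
theorem stubRoughMajorant_false_without_irreducible :
    ¬ ∀ (k : ℕ) (f : Fin k → Polynomial ℤ), (∀ i, 0 < (f i).leadingCoeff) →
      (Pairwise fun i j => ¬Associated (f i) (f j)) → HasNoFixedPrimeDivisor f →
      ∀ m₀ : ℕ, ∃ A C : ℝ, ∃ x₀ : ℕ, ∀ x : ℕ, x₀ ≤ x → ∀ z : ℂ, ‖z - 1‖ ≤ 3 * Real.log (Real.log (x : ℝ)) →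
        ‖(∑ n ∈ Finset.Ico m₀ (x + 1), (z : ℂ) ^ (∑ i, (((f i).eval (n : ℤ)).toNat.factorization.sum fun p v => if Real.log (Real.log (x : ℝ)) < (p : ℝ) then min v 2 else 0)))‖ ≤
          A * (x : ℝ) * (Real.log (x : ℝ) / Real.log (Real.log (Real.log (x : ℝ)))) ^ ((k : ℝ) * (z.re - 1)) * Real.exp (C * ‖(z : ℂ) - 1‖ * Real.log (‖(z : ℂ) - 1‖ + 2)) := by
  intro h
  obtain ⟨A, C, x₀, hb⟩ := h 1 ![X ^ 2] (fun i => by simp) Subsingleton.pairwise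
    (fun p hp => by rw [polyRootCountMod_eq_one sq_dvd_iff hp]; exact hp.one_lt) 0
  obtain ⟨x, ⟨hL, hlt⟩, hx⟩ := ((eventually_budget_lt A C le_rfl 0).and (eventually_ge_atTop x₀)).exists
  have hdisc : ‖(-1 : ℂ) - 1‖ ≤ 3 * Real.log (Real.log (x : ℝ)) := by
    have : ‖(-1 : ℂ) - 1‖ = 2 := by norm_num
    linarith
  have hmain := hb x hx (-1) hdisc
  rw [norm_sum_neg_one_pow_of_even (fun n => two_dvd_roughStat_sq _ n)] at hmain
  have h1 : ((x + 1 - 0 : ℕ) : ℝ) = (x : ℝ) + 1 := by push_cast; ring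
  have h2 : (x : ℝ) + 1 - ((0 : ℕ) : ℝ) = (x : ℝ) + 1 := by push_cast; ring
  rw [h1] at hmain
  rw [h2] at hlt
  exact (lt_irrefl _) (hmain.trans_lt hlt)

/-- DROP `pairwise_not_associated` ⇒ S6 FALSE. Witness `k = 2`, `f = ![X, X]` (irreducible, leading
coefficients `1`, `ω(p) = 1 < p`), `m₀ = 0`, `z = -1`: the rough statistic is `2 s♯(n)`, even, so
`R_x(0;-1) = x + 1` against the `o(x)` budget `A x U^{-4} e^{2C log 4}`. [folklore] -/
theorem stubRoughMajorant_false_without_pairwise_not_associated :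
    ¬ ∀ (k : ℕ) (f : Fin k → Polynomial ℤ), (∀ i, Irreducible (f i)) → (∀ i, 0 < (f i).leadingCoeff) →
      HasNoFixedPrimeDivisor f →
      ∀ m₀ : ℕ, ∃ A C : ℝ, ∃ x₀ : ℕ, ∀ x : ℕ, x₀ ≤ x → ∀ z : ℂ, ‖z - 1‖ ≤ 3 * Real.log (Real.log (x : ℝ)) →
        ‖(∑ n ∈ Finset.Ico m₀ (x + 1), (z : ℂ) ^ (∑ i, (((f i).eval (n : ℤ)).toNat.factorization.sum fun p v => if Real.log (Real.log (x : ℝ)) < (p : ℝ) then min v 2 else 0)))‖ ≤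
          A * (x : ℝ) * (Real.log (x : ℝ) / Real.log (Real.log (Real.log (x : ℝ)))) ^ ((k : ℝ) * (z.re - 1)) * Real.exp (C * ‖(z : ℂ) - 1‖ * Real.log (‖(z : ℂ) - 1‖ + 2)) := by
  intro h
  obtain ⟨A, C, x₀, hb⟩ := h 2 ![X, X]
    (fun i => by fin_cases i <;> simpa using Polynomial.prime_X.irreducible)
    (fun i => by fin_cases i <;> simp)
    (fun p hp => by rw [polyRootCountMod_eq_one pair_dvd_iff hp]; exact hp.one_lt) 0
  obtain ⟨x, ⟨hL, hlt⟩, hx⟩ :=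
    ((eventually_budget_lt A C (by norm_num : 1 ≤ 2) 0).and (eventually_ge_atTop x₀)).exists
  have hdisc : ‖(-1 : ℂ) - 1‖ ≤ 3 * Real.log (Real.log (x : ℝ)) := by
    have : ‖(-1 : ℂ) - 1‖ = 2 := by norm_num
    linarith
  have hmain := hb x hx (-1) hdisc
  rw [norm_sum_neg_one_pow_of_even (fun n => two_dvd_roughStat_pair _ n)] at hmain
  have h1 : ((x + 1 - 0 : ℕ) : ℝ) = (x : ℝ) + 1 := by push_cast; ring
  have h2 : (x : ℝ) + 1 - ((0 : ℕ) : ℝ) = (x : ℝ) + 1 := by push_cast; ring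
  rw [h1] at hmain
  rw [h2] at hlt
  exact (lt_irrefl _) (hmain.trans_lt hlt)

/-- DROP `leadingCoeff_pos` ⇒ S6 FALSE (the typed `Int.toNat` encoding makes it load-bearing). Witness
`k = 1`, `f = ![-X]` (`-X` is prime hence irreducible in `ℤ[X]`, `ω(p) = 1 < p`, pairwise vacuous), `m₀ = 0`,
`z = -1`: every value `-n ≤ 0` has `toNat = 0`, the rough statistic vanishes, `R_x(0;-1) = x + 1`, budget `o(x)`. [folklore] -/
theorem stubRoughMajorant_false_without_leadingCoeff_pos :
    ¬ ∀ (k : ℕ) (f : Fin k → Polynomial ℤ), (∀ i, Irreducible (f i)) →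
      (Pairwise fun i j => ¬Associated (f i) (f j)) → HasNoFixedPrimeDivisor f →
      ∀ m₀ : ℕ, ∃ A C : ℝ, ∃ x₀ : ℕ, ∀ x : ℕ, x₀ ≤ x → ∀ z : ℂ, ‖z - 1‖ ≤ 3 * Real.log (Real.log (x : ℝ)) →
        ‖(∑ n ∈ Finset.Ico m₀ (x + 1), (z : ℂ) ^ (∑ i, (((f i).eval (n : ℤ)).toNat.factorization.sum fun p v => if Real.log (Real.log (x : ℝ)) < (p : ℝ) then min v 2 else 0)))‖ ≤
          A * (x : ℝ) * (Real.log (x : ℝ) / Real.log (Real.log (Real.log (x : ℝ)))) ^ ((k : ℝ) * (z.re - 1)) * Real.exp (C * ‖(z : ℂ) - 1‖ * Real.log (‖(z : ℂ) - 1‖ + 2)) := by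
  intro h
  obtain ⟨A, C, x₀, hb⟩ := h 1 ![-X] (fun i => by simpa using Polynomial.prime_X.neg.irreducible)
    Subsingleton.pairwise (fun p hp => by rw [polyRootCountMod_eq_one negX_dvd_iff hp]; exact hp.one_lt) 0
  obtain ⟨x, ⟨hL, hlt⟩, hx⟩ := ((eventually_budget_lt A C le_rfl 0).and (eventually_ge_atTop x₀)).exists
  have hdisc : ‖(-1 : ℂ) - 1‖ ≤ 3 * Real.log (Real.log (x : ℝ)) := by
    have : ‖(-1 : ℂ) - 1‖ = 2 := by norm_num
    linarith
  have hmain := hb x hx (-1) hdisc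
  rw [norm_sum_neg_one_pow_of_even (fun n => by rw [roughStat_negX]; exact dvd_zero 2)] at hmain
  have h1 : ((x + 1 - 0 : ℕ) : ℝ) = (x : ℝ) + 1 := by push_cast; ring
  have h2 : (x : ℝ) + 1 - ((0 : ℕ) : ℝ) = (x : ℝ) + 1 := by push_cast; ring
  rw [h1] at hmain
  rw [h2] at hlt
  exact (lt_irrefl _) (hmain.trans_lt hlt)


/-- `C 3`: once `3 ≤ L` the prime `3` is smooth, so the rough statistic of the constant value `3` vanishes. [folklore] -/
theorem roughStat_C_three {L : ℝ} (hL : 3 ≤ L) (n : ℕ) :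
    (∑ i, ((((![(C 3 : ℤ[X])] : Fin 1 → ℤ[X]) i).eval (n : ℤ)).toNat.factorization.sum
      fun p v => if L < (p : ℝ) then min v 2 else 0)) = 0 := by
  simp only [Fin.sum_univ_one, Matrix.cons_val_fin_one, eval_C]
  rw [show ((3 : ℤ)).toNat = 3 from rfl, Nat.prime_three.factorization, Finsupp.sum_single_index]
  · simp only [Nat.cast_ofNat]
    rw [if_neg (by linarith)]
  · simp

/-- DROP `hasNoFixedPrimeDivisor` ⇒ S6 FALSE as typed — through the CONSTANT prime `C 3` (irreducible in `ℤ[X]`,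
leading coefficient `3 > 0`, pairwise vacuous; fixed prime divisor `3`): for `log log x ≥ 3` the prime `3` is smooth,
the rough statistic vanishes and `R_x(0;-1) = x + 1` against the `o(x)` budget. (So the hypothesis class of any
proof of S6 must exclude constants; within `IsBatemanHornSystem` only `hasNoFixedPrimeDivisor` does.) [folklore] -/
theorem stubRoughMajorant_false_without_hasNoFixedPrimeDivisor :
    ¬ ∀ (k : ℕ) (f : Fin k → Polynomial ℤ), (∀ i, Irreducible (f i)) → (∀ i, 0 < (f i).leadingCoeff) →
      (Pairwise fun i j => ¬Associated (f i) (f j)) →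
      ∀ m₀ : ℕ, ∃ A C : ℝ, ∃ x₀ : ℕ, ∀ x : ℕ, x₀ ≤ x → ∀ z : ℂ, ‖z - 1‖ ≤ 3 * Real.log (Real.log (x : ℝ)) →
        ‖(∑ n ∈ Finset.Ico m₀ (x + 1), (z : ℂ) ^ (∑ i, (((f i).eval (n : ℤ)).toNat.factorization.sum fun p v => if Real.log (Real.log (x : ℝ)) < (p : ℝ) then min v 2 else 0)))‖ ≤
          A * (x : ℝ) * (Real.log (x : ℝ) / Real.log (Real.log (Real.log (x : ℝ)))) ^ ((k : ℝ) * (z.re - 1)) * Real.exp (C * ‖(z : ℂ) - 1‖ * Real.log (‖(z : ℂ) - 1‖ + 2)) := by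
  intro h
  obtain ⟨hirr, hlc, hpw⟩ := C_three_other_fields
  obtain ⟨A, C', x₀, hb⟩ := h 1 ![(C 3 : ℤ[X])] hirr hlc hpw 0
  obtain ⟨x, ⟨⟨hL, hlt⟩, hL3⟩, hx⟩ :=
    (((eventually_budget_lt A C' le_rfl 0).and
      (tendsto_loglog_atTop.eventually (eventually_ge_atTop 3))).and (eventually_ge_atTop x₀)).exists
  have hdisc : ‖(-1 : ℂ) - 1‖ ≤ 3 * Real.log (Real.log (x : ℝ)) := by
    have : ‖(-1 : ℂ) - 1‖ = 2 := by norm_num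
    linarith
  have hmain := hb x hx (-1) hdisc
  rw [norm_sum_neg_one_pow_of_even (fun n => by rw [roughStat_C_three hL3]; exact dvd_zero 2)] at hmain
  have h1 : ((x + 1 - 0 : ℕ) : ℝ) = (x : ℝ) + 1 := by push_cast; ring
  have h2 : (x : ℝ) + 1 - ((0 : ℕ) : ℝ) = (x : ℝ) + 1 := by push_cast; ring
  rw [h1] at hmain
  rw [h2] at hlt
  exact (lt_irrefl _) (hmain.trans_lt hlt)

end Summit.Parity.BatemanHorn.Theorems.SystemZeroRepulsion.Negative
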